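import Summits.CriticalPhenomena.PercolationContinuityZ3.Theorems.SoloInformedCrossingLowerBound
import Summits.CriticalPhenomena.PercolationContinuityZ3.Theorems.SoloInformedCubeFace
import Summits.CriticalPhenomena.PercolationContinuityZ3.Theorems.SoloInformedCubeCrossing
import Summits.CriticalPhenomena.PercolationContinuityZ3.Theorems.SoloInformedSlabBoxFace
import Summits.CriticalPhenomena.PercolationContinuityZ3.Theorems.SoloInformedBoxCrossingFace
import Summits.CriticalPhenomena.PercolationContinuityZ3.Theorems.PercNearOneGluingNoHeavyQuantPolylogOneArm
import Summits.CriticalPhenomena.PercolationContinuityZ3.Theorems.PercNearOneGluingNoHeavyLowerTailCSHTheoremOne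
import Literature.Probability.Percolation.CriticalOneArmBKLowerBound
import Literature.Probability.LatticeModels.ThermodynamicLimit
import HarnessLib

/-!
# RSW3 lane (P2, method "3D RSW-lite from continuity"): the critical CROSSING WINDOW of `ℤ^d`, `d ≥ 2`

builds on p205010 (kernel theorem, internal audit signed; external expert review pending)

Cell `prim-rsw3` (post-continuity programme, LANE 3 "box crossing / quasi-multiplicativity at
`p_c(ℤ³)`"), prover seat `prim-rsw3-p2`, memo `run/shared/lean/prim/rsw3/P2-RSWLITE.md`.
Support file (`--supports stmt-CriticalPhenomena-4575`); no definitions, no named facts, no sorries.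

What is recorded here is the a-priori window in which the critical crossing probabilities of
`ℤ^d` live, assembled from kernel theorems already in the tree, in the three regimes of the
aspect ratio `ρ = (length to cross) / (width)` of a box crossed inside itself:

* **(W) window.** `85^{-d} ≤ P_{p_c}(Λ(n) ↔ ∂ⁱⁿΛ(N) in Λ(N))` whenever `1 ≤ L ≤ n ≤ N ≤ 4L`
  (`le_real_boxCrossing_criticalProbI`; Kesten's sponge bound `le_crossProb_criticalProbI` plus the
  two monotonicities of `boxCrossing`).
* **(S1, ρ < 1) thin crossings are bounded below uniformly in the scale.**
  `85^{-d}/(2d) ≤ P_{p_c}(the 1:3 slab-box S_{i,ε}(n) is crossed the thin way inside itself)`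
  (`le_real_thinCrossing_criticalProbI`) and, for EVERY `r ≥ 1` and every mesh `u ≥ 1`,
  `85^{-d}/(d (4r+5)^d) ≤ P_{p_c}(the near-cube [u,(r+1)u] × [0,(r+2)u]^{d-1} is crossed the thin way)`
  (`le_real_slabCrossing_criticalProbI`): aspect `r : (r+2)`, i.e. every `ρ < 1`, with a constant that
  degenerates as `ρ ↑ 1`.  (Union bound over the composition lemmas
  `boxCrossing_subset_iUnion_thinCrossing` / `boxCrossing_subset_iUnion_slabCrossing` and the lattice
  symmetries `real_thinCrossing_eq` / `real_slabCrossing_eq`.)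
* **(S1, ρ = 1) the exact cube: an explicit polynomial rate, not a uniform bound.** For every `p`,
  `(π_p(L)/(2d))² ≤ P_p(Λ(L) crossed inside itself from {x_k = -L} to {x_k = L})`
  (`sq_oneArmProb_div_le_real_cubeCrossing`, square-root trick), hence at `p_c`, with the two-arm count
  `π_{p_c}(L)² ≥ c/L^{d-1}` (`exists_oneArmProb_criticalProbI_sq_lower`):
  `c_d / L^{d-1} ≤ P_{p_c}(cube Λ(L) crossed face to opposite face)` (`exists_le_real_cubeCrossing_criticalProbI`;
  `d = 3`: `c/L²`).  So hard(est uniform-width)-direction crossings of the `n × n × n` cube cannot tend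
  to `0` faster than `n^{-2}`; a UNIFORM lower bound for the exact cube at `p_c(ℤ³)` is not in the
  tree and not in print (Duminil-Copin–Kozma–Tassion 2020 §1.1; van den Berg–Don 2020, intro).
* **(Y, from continuity) the window COLLAPSES at free outer scale.** Unconditionally, for every
  `d ≥ 2` and every `n`, `P_{p_c}(Λ(n) ↔ ∂ⁱⁿΛ(N) in Λ(N)) → 0` as `N → ∞`
  (`tendsto_real_boxCrossing_criticalProbI` = row (Y) `tendsto_real_boxCrossing_of_continuity` fed with
  `CSH.percolationContinuity_allDimensions`, p205010), so the "defect scale"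
  `F_ε(n) = min {N : P_{p_c}(boxCrossing d n N) ≤ ε}` is finite for every `ε > 0`
  (`exists_real_boxCrossing_criticalProbI_le`) while `F_ε(n) > 4n` as soon as `ε < 85^{-d}`
  (`lt_of_real_boxCrossing_criticalProbI_lt`).  No RATE for `F` follows from continuity: a bound
  `F_δ(n) ≤ 2n` is the hyperscaling statement `CritAnnulusNonCrossing` (route `PercAnnulusCrossing`, open;
  false for `d > 6`, barrier `SpanningClustersAboveSix`), and `F_δ(n) ≤ n^α` already gives a polylog one-arm
  rate (QUANT lane, `Quant.oneArmProb_le_rpow_log_of_polyAspectDefect`).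

References: H. Kesten, *Percolation Theory for Mathematicians* (1982), Thm. 5.1 / Cor. 5.1 (sponge
crossings at `p_T = p_H`); G. Grimmett, *Percolation* (1999), §11.7 (square-root trick); J. van den Berg,
H. Kesten, J. Appl. Probab. 22 (1985) (BK); H. Duminil-Copin, G. Kozma, V. Tassion, arXiv:1902.03207 §1.1
(status of finite-size criteria in `3 ≤ d ≤ 6`); J. van den Berg, H. Don, Electron. Commun. Probab. 25
(2020), arXiv:1912.10964 (point-to-point lower bounds `|x|^{-d²}`). [folklore]
-/

noncomputable section

namespace Summit.CriticalPhenomena.PercolationContinuityZ3.Theorems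

open MeasureTheory ProbabilityTheory Filter Topology
open Literature.Probability.Percolation Literature.Probability.LatticeModels

namespace Rsw3

open SurfaceTension

variable {d : ℕ}

/-! ## (W) The window `[85^{-d}, 1]` for all aspect ratios between `1` and `4` -/

/-- **(W)** For `1 ≤ L ≤ n ≤ N ≤ 4L`: `85^{-d} ≤ P_{p_c}(Λ(n) ↔ ∂ⁱⁿΛ(N) in Λ(N))` on `ℤ^d`, `d ≥ 2`
(Kesten's sponge lower bound at aspect `4`, `le_crossProb_criticalProbI`, moved to the pair `(n, N)` by
`boxCrossing_mono_left` and `boxCrossing_anti`). [cite: Kesten1982, Cor. 5.1] -/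
theorem le_real_boxCrossing_criticalProbI (hd : 2 ≤ d) {L n N : ℕ} (hL : 1 ≤ L) (hLn : L ≤ n)
    (hnN : n ≤ N) (hN : N ≤ 4 * L) :
    ((85 : ℝ) ^ d)⁻¹ ≤ (bondPercolation (zdGraph d) (criticalProbI d)).real (boxCrossing d n N) := by
  refine (le_crossProb_criticalProbI hd hL).trans ?_
  rw [crossProb]
  exact measureReal_mono fun ω hω => boxCrossing_anti hnN hN (boxCrossing_mono_left hLn _ hω)

/-- **(W) at aspect `3`**: `85^{-d} ≤ P_{p_c}(Λ(n) ↔ ∂ⁱⁿΛ(3n) in Λ(3n))`, `n ≥ 1`. [cite: Kesten1982, Cor. 5.1] -/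
theorem le_real_boxCrossing_three_mul_criticalProbI (hd : 2 ≤ d) {n : ℕ} (hn : 1 ≤ n) :
    ((85 : ℝ) ^ d)⁻¹ ≤
      (bondPercolation (zdGraph d) (criticalProbI d)).real (boxCrossing d n (3 * n)) :=
  le_real_boxCrossing_criticalProbI hd hn le_rfl (by omega) (by omega)

/-- **(W) at aspect `2`**: `85^{-d} ≤ P_{p_c}(Λ(m) ↔ ∂ⁱⁿΛ(2m) in Λ(2m))`, `m ≥ 1` (the events of
`CritAnnulusNonCrossing` / row (Y) at ratio `2`, for every `m`, not only even ones). [cite: Kesten1982, Cor. 5.1] -/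
theorem le_real_boxCrossing_two_mul_criticalProbI (hd : 2 ≤ d) {m : ℕ} (hm : 1 ≤ m) :
    ((85 : ℝ) ^ d)⁻¹ ≤
      (bondPercolation (zdGraph d) (criticalProbI d)).real (boxCrossing d m (2 * m)) :=
  le_real_boxCrossing_criticalProbI hd hm le_rfl (by omega) (by omega)

/-! ## (S1, `ρ < 1`) Thin crossings: uniform lower bounds -/

/-- **(S1) slab-boxes, aspect `1:3`.** On `ℤ^d`, `d ≥ 2`, for every `n ≥ 1`, direction `i` and sign `ε`:
`85^{-d}/(2d) ≤ P_{p_c}(S_{i,ε}(n) = {x ∈ Λ(3n) : n ≤ ε x_i} is crossed inside itself from {ε x_i = 3n} to {ε x_i = n})`.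
Union bound over the `2d` slab-boxes of the composition lemma `boxCrossing_subset_iUnion_thinCrossing`,
all of the same probability (`real_thinCrossing_eq`), under the window (W) at aspect `3`. [folklore] -/
theorem le_real_thinCrossing_criticalProbI (hd : 2 ≤ d) {n : ℕ} (hn : 1 ≤ n) (i : Fin d) (ε : ℤˣ) :
    ((85 : ℝ) ^ d)⁻¹ / (2 * d) ≤
      (bondPercolation (zdGraph d) (criticalProbI d)).real (thinCrossing n i ε) := by
  set μ := bondPercolation (zdGraph d) (criticalProbI d) with hμ
  have hd1' : (1 : ℝ) ≤ d := by exact_mod_cast (by omega : 1 ≤ d)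
  have hd0 : (0 : ℝ) < 2 * d := by linarith
  have hwin : ((85 : ℝ) ^ d)⁻¹ ≤ μ.real (boxCrossing d n (3 * n)) :=
    le_real_boxCrossing_three_mul_criticalProbI hd hn
  have hU : μ.real (boxCrossing d n (3 * n)) ≤
      μ.real (⋃ q : Fin d × ℤˣ, thinCrossing n q.1 q.2) := by
    refine measureReal_mono fun ω hω => ?_
    obtain ⟨i', hi'⟩ := Set.mem_iUnion.1 (boxCrossing_subset_iUnion_thinCrossing hn hω)
    obtain ⟨ε', hε'⟩ := Set.mem_iUnion.1 hi'
    exact Set.mem_iUnion.2 ⟨(i', ε'), hε'⟩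
  have hsum : μ.real (⋃ q : Fin d × ℤˣ, thinCrossing n q.1 q.2) ≤
      ∑ q : Fin d × ℤˣ, μ.real (thinCrossing n q.1 q.2) :=
    measureReal_iUnion_fintype_le _
  have hterm : ∀ q : Fin d × ℤˣ, μ.real (thinCrossing n q.1 q.2) = μ.real (thinCrossing n i 1) :=
    fun q => real_thinCrossing_eq (criticalProbI d) n q.1 i q.2
  have hself : μ.real (thinCrossing n i ε) = μ.real (thinCrossing n i 1) :=
    real_thinCrossing_eq (criticalProbI d) n i i ε
  have hcard : ∑ q : Fin d × ℤˣ, μ.real (thinCrossing n q.1 q.2) =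
      2 * d * μ.real (thinCrossing n i 1) := by
    rw [Finset.sum_congr rfl fun q _ => hterm q, Finset.sum_const, Finset.card_univ,
      Fintype.card_prod, Fintype.card_fin, Fintype.card_units_int, nsmul_eq_mul]
    push_cast
    ring
  rw [hself, div_le_iff₀ hd0]
  have := (hwin.trans hU).trans (hsum.trans_eq hcard)
  linarith

/-- **(S1) near-cubes, aspect `r:(r+2)` — every aspect ratio `ρ < 1`.** On `ℤ^d`, `d ≥ 2`, for every
`r ≥ 1`, mesh `u ≥ 1`, direction `k` and grid index `g`:
`85^{-d}/(d (4r+5)^d) ≤ P_{p_c}(the brick u g + [u,(r+1)u] × [0,(r+2)u]^{d-1} is crossed the thin way inside itself)`.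
Union bound over the `d (4r+5)^d` bricks of the composition lemma `boxCrossing_subset_iUnion_slabCrossing`
(the cube lemma rounded to the `u`-grid), all of the same probability (`real_slabCrossing_eq`), under the
window (W) at aspect `2` for `m = (r+1)u`.  The constant does not depend on the mesh `u`: a uniform-in-scale
lower bound for thin crossings of bricks as close to a cube as one likes. [folklore] -/
theorem le_real_slabCrossing_criticalProbI (hd : 2 ≤ d) {u r : ℕ} (hu : 1 ≤ u) (hr : 1 ≤ r)
    (k : Fin d) (g : Site d) :
    ((85 : ℝ) ^ d)⁻¹ / (d * (4 * r + 5) ^ d) ≤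
      (bondPercolation (zdGraph d) (criticalProbI d)).real (slabCrossing u r k g) := by
  classical
  set μ := bondPercolation (zdGraph d) (criticalProbI d) with hμ
  have hd1 : (1 : ℝ) ≤ d := by exact_mod_cast (by omega : 1 ≤ d)
  have hK0 : (0 : ℝ) < d * (4 * r + 5) ^ d := by positivity
  have hm : 1 ≤ (r + 1) * u := Nat.le_of_lt_succ (by nlinarith)
  have hwin : ((85 : ℝ) ^ d)⁻¹ ≤ μ.real (boxCrossing d ((r + 1) * u) (2 * ((r + 1) * u))) :=
    le_real_boxCrossing_two_mul_criticalProbI hd hm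
  have hU : μ.real (boxCrossing d ((r + 1) * u) (2 * ((r + 1) * u))) ≤
      μ.real (⋃ k' : Fin d, ⋃ g' ∈ box d (2 * r + 2), slabCrossing u r k' g') :=
    measureReal_mono (boxCrossing_subset_iUnion_slabCrossing hu hr)
  have hsum₁ : μ.real (⋃ k' : Fin d, ⋃ g' ∈ box d (2 * r + 2), slabCrossing u r k' g') ≤
      ∑ k' : Fin d, μ.real (⋃ g' ∈ box d (2 * r + 2), slabCrossing u r k' g') :=
    measureReal_iUnion_fintype_le _
  have hsum₂ : ∀ k' : Fin d, μ.real (⋃ g' ∈ box d (2 * r + 2), slabCrossing u r k' g') ≤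
      ∑ g' ∈ box d (2 * r + 2), μ.real (slabCrossing u r k' g') :=
    fun k' => measureReal_biUnion_finset_le _ _
  have hterm : ∀ (k' : Fin d) (g' : Site d),
      μ.real (slabCrossing u r k' g') = μ.real (slabCrossing u r k 0) :=
    fun k' g' => real_slabCrossing_eq (criticalProbI d) u r k' k g'
  have hself : μ.real (slabCrossing u r k g) = μ.real (slabCrossing u r k 0) :=
    real_slabCrossing_eq (criticalProbI d) u r k k g
  have hcard : (box d (2 * r + 2)).card = (4 * r + 5) ^ d := by
    rw [card_box]; ring_nf
  have hinner : ∀ k' : Fin d, ∑ g' ∈ box d (2 * r + 2), μ.real (slabCrossing u r k' g') =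
      (4 * r + 5) ^ d * μ.real (slabCrossing u r k 0) := by
    intro k'
    rw [Finset.sum_congr rfl fun g' _ => hterm k' g', Finset.sum_const, hcard, nsmul_eq_mul]
    push_cast
    ring
  have htot : ∑ k' : Fin d, μ.real (⋃ g' ∈ box d (2 * r + 2), slabCrossing u r k' g') ≤
      d * (4 * r + 5) ^ d * μ.real (slabCrossing u r k 0) := by
    calc ∑ k' : Fin d, μ.real (⋃ g' ∈ box d (2 * r + 2), slabCrossing u r k' g')
        ≤ ∑ k' : Fin d, ∑ g' ∈ box d (2 * r + 2), μ.real (slabCrossing u r k' g') :=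
          Finset.sum_le_sum fun k' _ => hsum₂ k'
      _ = ∑ _k' : Fin d, (4 * r + 5 : ℝ) ^ d * μ.real (slabCrossing u r k 0) :=
          Finset.sum_congr rfl fun k' _ => hinner k'
      _ = d * (4 * r + 5) ^ d * μ.real (slabCrossing u r k 0) := by
          rw [Finset.sum_const, Finset.card_univ, Fintype.card_fin, nsmul_eq_mul]; ring
  rw [hself, div_le_iff₀ hK0]
  have := (hwin.trans hU).trans (hsum₁.trans htot)
  linarith

/-! ## (S1, `ρ = 1`) The exact cube: a polynomial rate -/

/-- **Square-root trick with the one-arm probability**: for every `p`, `L`, direction `k` (`d ≥ 1`),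
`(π_p(L)/(2d))² ≤ P_p(Λ(L) is crossed inside itself from {x_k = -L} to {x_k = L})`.
(`{0 ↔ ∂Λ(L)} ⊆ boxCrossing d 0 L ⊆ ⋃_{k,ε} F_{k,ε}`, the `2d` centre-to-face events having equal
probabilities, so `π_p(L) ≤ 2d P_p(F_{k,+1})`; then `P(F_{k,+1})² ≤ P(cube crossed)` is
`sq_centreToFace_le_cubeCrossing`.) [folklore] -/
theorem sq_oneArmProb_div_le_real_cubeCrossing (hd : 1 ≤ d) (p : unitInterval) (L : ℕ) (k : Fin d) :
    (oneArmProb d p L / (2 * d)) ^ 2 ≤ (bondPercolation (zdGraph d) p).real (cubeCrossing L k) := by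
  set μ := bondPercolation (zdGraph d) p with hμ
  have hd1' : (1 : ℝ) ≤ d := by exact_mod_cast hd
  have hd0 : (0 : ℝ) < 2 * d := by linarith
  have h1 : oneArmProb d p L ≤ μ.real (boxCrossing d 0 L) := Quant.oneArmProb_le_real_boxCrossing p L
  have h2 : μ.real (boxCrossing d 0 L) ≤ μ.real (⋃ q : Fin d × ℤˣ, centreToFace L q.1 q.2) := by
    refine measureReal_mono fun ω hω => ?_
    obtain ⟨k', hk'⟩ := Set.mem_iUnion.1 (boxCrossing_zero_subset_iUnion_centreToFace L hω)
    obtain ⟨ε', hε'⟩ := Set.mem_iUnion.1 hk'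
    exact Set.mem_iUnion.2 ⟨(k', ε'), hε'⟩
  have h3 : μ.real (⋃ q : Fin d × ℤˣ, centreToFace L q.1 q.2) ≤
      ∑ q : Fin d × ℤˣ, μ.real (centreToFace L q.1 q.2) :=
    measureReal_iUnion_fintype_le _
  have h4 : ∑ q : Fin d × ℤˣ, μ.real (centreToFace L q.1 q.2) = 2 * d * μ.real (centreToFace L k 1) := by
    rw [Finset.sum_congr rfl fun q _ => real_centreToFace_eq p L q.1 k q.2, Finset.sum_const,
      Finset.card_univ, Fintype.card_prod, Fintype.card_fin, Fintype.card_units_int, nsmul_eq_mul]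
    push_cast
    ring
  have hq : oneArmProb d p L / (2 * d) ≤ μ.real (centreToFace L k 1) := by
    rw [div_le_iff₀ hd0]
    have := (h1.trans h2).trans (h3.trans_eq h4)
    linarith
  have h0 : 0 ≤ oneArmProb d p L / (2 * d) := div_nonneg measureReal_nonneg hd0.le
  exact (pow_le_pow_left₀ h0 hq 2).trans (sq_centreToFace_le_cubeCrossing p L k)

/-- **(S1, `ρ = 1`) the critical cube is crossed with probability at least `c_d / L^{d-1}`.** On `ℤ^d`,
`d ≥ 2`, there is `c = c(d) > 0` with
`c / L^{d-1} ≤ P_{p_c}(Λ(L) is crossed inside itself from {x_k = -L} to {x_k = L})` for all `L ≥ 1` and all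
directions `k`: the square-root trick `sq_oneArmProb_div_le_real_cubeCrossing` at `p_c` with the two-arm
count `π_{p_c}(L)² ≥ c'/L^{d-1}` (`exists_oneArmProb_criticalProbI_sq_lower`).  An explicit polynomial
RATE below which the face-to-opposite-face crossing probability of the critical cube cannot fall; a bound
uniform in `L` is the open lower half of a `d`-dimensional box-crossing property. [folklore] -/
theorem exists_le_real_cubeCrossing_criticalProbI (hd : 2 ≤ d) :
    ∃ c : ℝ, 0 < c ∧ ∀ L : ℕ, 1 ≤ L → ∀ k : Fin d,
      c / (L : ℝ) ^ (d - 1) ≤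
        (bondPercolation (zdGraph d) (criticalProbI d)).real (cubeCrossing L k) := by
  obtain ⟨c, hc, h⟩ := exists_oneArmProb_criticalProbI_sq_lower hd
  have hd1 : 1 ≤ d := by omega
  have hd1' : (1 : ℝ) ≤ d := by exact_mod_cast hd1
  have hd0 : (0 : ℝ) < 2 * d := by linarith
  refine ⟨c / (2 * d) ^ 2, by positivity, fun L hL k => ?_⟩
  have hsq := sq_oneArmProb_div_le_real_cubeCrossing hd1 (criticalProbI d) L k
  have hL0 : (0 : ℝ) < (L : ℝ) ^ (d - 1) := by positivity
  calc c / (2 * d) ^ 2 / (L : ℝ) ^ (d - 1) = (c / (L : ℝ) ^ (d - 1)) / (2 * d) ^ 2 := by ring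
    _ ≤ oneArmProb d (criticalProbI d) L ^ 2 / (2 * d) ^ 2 :=
        div_le_div_of_nonneg_right (h L hL) (by positivity)
    _ = (oneArmProb d (criticalProbI d) L / (2 * d)) ^ 2 := by rw [div_pow]
    _ ≤ _ := hsq

/-- The `ℤ³` instance of (S1, `ρ = 1`): `c / L² ≤ P_{p_c(ℤ³)}(Λ(L) crossed face to opposite face inside itself)`
for all `L ≥ 1`, all three directions. [folklore] -/
theorem exists_le_real_cubeCrossing_criticalProbI_three :
    ∃ c : ℝ, 0 < c ∧ ∀ L : ℕ, 1 ≤ L → ∀ k : Fin 3,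
      c / (L : ℝ) ^ 2 ≤ (bondPercolation (zdGraph 3) (criticalProbI 3)).real (cubeCrossing L k) := by
  obtain ⟨c, hc, h⟩ := exists_le_real_cubeCrossing_criticalProbI (d := 3) (by norm_num)
  exact ⟨c, hc, fun L hL k => by simpa using h L hL k⟩

/-! ## (Y) From continuity: the window collapses at free outer scale, in every dimension -/

/-- **(Y) from p205010, unconditionally.** For every `d ≥ 2` and every `n`,
`P_{p_c}(Λ(n) ↔ ∂ⁱⁿΛ(N) in Λ(N)) → 0` as `N → ∞`: row (Y) `tendsto_real_boxCrossing_of_continuity` fed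
with `θ_{ℤ^d}(p_c) = 0` (`CSH.percolationContinuity_allDimensions`; builds on p205010 (kernel theorem,
internal audit signed; external expert review pending)).  Together with (W): at each fixed inner scale the
crossing probability starts `≥ 85^{-d}` at `N = 4n` and nevertheless tends to `0`.
[cite: KozmaNitzan2024, Thm. 6 with Conj. 3 (p. 15)] -/
theorem tendsto_real_boxCrossing_criticalProbI (hd : 2 ≤ d) (n : ℕ) :
    Tendsto (fun N => (bondPercolation (zdGraph d) (criticalProbI d)).real (boxCrossing d n N))
      atTop (𝓝 0) :=
  tendsto_real_boxCrossing_of_continuity (CSH.percolationContinuity_allDimensions d hd) n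

/-- **The defect scale function is finite.** For every `d ≥ 2`, `n` and `ε > 0` there is `N₀` with
`P_{p_c}(Λ(n) ↔ ∂ⁱⁿΛ(N) in Λ(N)) ≤ ε` for all `N ≥ N₀` — i.e.
`F_ε(n) := min {N : P_{p_c}(boxCrossing d n N) ≤ ε} < ∞` (QUANT lane's defect scale function; no growth
bound on `F` follows from continuity). [folklore] -/
theorem exists_real_boxCrossing_criticalProbI_le (hd : 2 ≤ d) (n : ℕ) {ε : ℝ} (hε : 0 < ε) :
    ∃ N₀ : ℕ, ∀ N : ℕ, N₀ ≤ N →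
      (bondPercolation (zdGraph d) (criticalProbI d)).real (boxCrossing d n N) ≤ ε := by
  have h := (tendsto_real_boxCrossing_criticalProbI hd n).eventually (ge_mem_nhds hε)
  obtain ⟨N₀, hN₀⟩ := eventually_atTop.1 h
  exact ⟨N₀, hN₀⟩

/-- **The defect scale exceeds `4n` below the window.** If `P_{p_c}(boxCrossing d n N) < 85^{-d}` with
`1 ≤ n ≤ N` then `4n < N`: inside the aspect range `[1, 4]` the window (W) forbids any defect larger than
`1 - 85^{-d}`. [cite: Kesten1982, Cor. 5.1] -/
theorem lt_of_real_boxCrossing_criticalProbI_lt (hd : 2 ≤ d) {n N : ℕ} (hn : 1 ≤ n) (hnN : n ≤ N)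
    (h : (bondPercolation (zdGraph d) (criticalProbI d)).real (boxCrossing d n N) < ((85 : ℝ) ^ d)⁻¹) :
    4 * n < N := by
  by_contra hle
  push Not at hle
  exact absurd (le_real_boxCrossing_criticalProbI hd hn le_rfl hnN hle) (not_le.2 h)

/-- **The `ℤ³` two-sided statement.** At `p_c(ℤ³)`, for every `n ≥ 1`: the annulus `Λ(n) ↔ ∂ⁱⁿΛ(4n)`
is crossed with probability `≥ 85^{-3}`, the `1:3` slab-boxes are thin-crossed with probability
`≥ 85^{-3}/6`, and yet `P_{p_c}(Λ(n) ↔ ∂ⁱⁿΛ(N) in Λ(N)) → 0` as `N → ∞`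
(builds on p205010 (kernel theorem, internal audit signed; external expert review pending)). [folklore] -/
theorem crossingWindow_Z3 {n : ℕ} (hn : 1 ≤ n) :
    ((85 : ℝ) ^ 3)⁻¹ ≤ (bondPercolation (zdGraph 3) (criticalProbI 3)).real (boxCrossing 3 n (4 * n)) ∧
      (∀ (i : Fin 3) (ε : ℤˣ), ((85 : ℝ) ^ 3)⁻¹ / 6 ≤
        (bondPercolation (zdGraph 3) (criticalProbI 3)).real (thinCrossing n i ε)) ∧
      Tendsto (fun N => (bondPercolation (zdGraph 3) (criticalProbI 3)).real (boxCrossing 3 n N))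
        atTop (𝓝 0) := by
  refine ⟨le_real_boxCrossing_criticalProbI (by norm_num) hn le_rfl (by omega) le_rfl, fun i ε => ?_,
    tendsto_real_boxCrossing_criticalProbI (by norm_num) n⟩
  have h := le_real_thinCrossing_criticalProbI (d := 3) (by norm_num) hn i ε
  norm_num at h ⊢
  exact h

end Rsw3

end Summit.CriticalPhenomena.PercolationContinuityZ3.Theorems

end
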